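import Summits.NavierStokesRegularity.NavierStokesRegularity.Theorems.SelfMixingDichotomyMixingPayoffAdvectionDiffusionMildTools
import HarnessLib

/-!
# Crux `MixingPayoff` (stmt-NavierStokesRegularity-1422), line `birth`, stub W2
  (`stub_advectionDiffusionSchwartz`): mild solutions of `∂ₜu = Δu + f(x, u, ∂u)` with an
  EXPLICIT existence time

Helper file (lands `--supports stmt-NavierStokesRegularity-1422`). The tree's
`Literature.Analysis.PDE.SemilinearHeat.exists_mild_solution` (Taylor, *PDE III*, Ch. 15, §1,
Prop. 1.1: contraction in `C([0,T]; C¹_b)`) returns an existence time `T` hidden behind an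
existential. To restart the construction finitely many times along a compact time interval
(the linear advection–diffusion equation of stub W2 is solved window by window) one needs `T`
as an explicit function of the sup bound `M` and the Lipschitz bound `Lf` of the nonlinearity
on the ball `‖(u, p)‖ ≤ R`:

  `T = δ²`, `δ = min (1 / (4c(Lf + 1))) (1 / (2cM + 1))`, `c = 2^{dim E / 2}`.

`mild_solution_explicit` is the tree's theorem and proof VERBATIM (minus the translation
invariance, not needed here) with this `T` in the statement.
-/

noncomputable section

open MeasureTheory Set Function Filter Metric Real
open _root_.Topology
open scoped ENNReal NNReal ContDiff

-- `Summit = Problem` for this summit; the tree lakefile sets `weak.linter.dupNamespace = false`.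
set_option linter.dupNamespace false

namespace Summit.NavierStokesRegularity.NavierStokesRegularity.Theorems.SelfMixingDichotomy.MixingPayoffBirth

open Literature.Analysis.UnboundedOperators Literature.Analysis.UnboundedOperators.HeatHolder
open Literature.Analysis.FluidPDE Literature.Analysis.PDE.SemilinearHeat

-- nested operator types `E →L[ℝ] E →L[ℝ] V`
set_option maxSynthPendingDepth 3

variable {E : Type*} [NormedAddCommGroup E] [InnerProductSpace ℝ E] [FiniteDimensional ℝ E]
  [MeasurableSpace E] [BorelSpace E]
variable {V : Type*} [NormedAddCommGroup V] [NormedSpace ℝ V] [CompleteSpace V]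

set_option maxHeartbeats 1600000 in
/-- **Short-time mild solutions of `∂ₜu = Δu + f(x, u, ∂u)` with an explicit existence time**
(Taylor, *PDE III*, Ch. 15, §1, Prop. 1.1; the tree's `SemilinearHeat.exists_mild_solution`
with the time made explicit). Let `f` be continuous, bounded by `M` and `Lf`-Lipschitz in
`(u, p)` on `E × {‖(u, p)‖ ≤ R}`, `u₀ ∈ C¹` with `‖u₀‖, ‖∂u₀‖ ≤ A₀`, `A₀ + 1 ≤ R`, and
`T = (min (1/(4c(Lf+1))) (1/(2cM+1)))²`, `c = 2^{dim E/2}`. Then `0 < T ≤ 1` and there is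
`u : ℝ → E → V` with `u(0) = u₀` (`u(t) = u₀` off `(0, T]`), every slice `C¹` with
`‖u(t)‖, ‖∂u(t)‖ ≤ R`, `u`, `∂u` jointly measurable, solving
`u(t) = e^{tΔ}u₀ + ∫₀ᵗ e^{(t−s)Δ}f(·, u(s), ∂u(s)) ds` for `t ∈ (0, T]`. -/
theorem mild_solution_explicit (f : E × V × (E →L[ℝ] V) → V) (hfc : Continuous f)
    {u₀ : E → V} {A₀ : ℝ} (hu₀ : IsCkBounded 1 A₀ u₀)
    {R M Lf : ℝ} (hR : A₀ + 1 ≤ R) (hM : 0 ≤ M) (hLf : 0 ≤ Lf)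
    (hfM : ∀ (x : E) (w : V × (E →L[ℝ] V)), ‖w‖ ≤ R → ‖f (x, w)‖ ≤ M)
    (hfL : ∀ (x : E) (w w' : V × (E →L[ℝ] V)), ‖w‖ ≤ R → ‖w'‖ ≤ R →
      ‖f (x, w) - f (x, w')‖ ≤ Lf * ‖w - w'‖)
    {T : ℝ} (hTdef : T = (min (1 / (4 * (2 : ℝ) ^ ((Module.finrank ℝ E : ℝ) / 2) * (Lf + 1)))
      (1 / (2 * (2 : ℝ) ^ ((Module.finrank ℝ E : ℝ) / 2) * M + 1))) ^ 2) :
    0 < T ∧ T ≤ 1 ∧ ∃ u : ℝ → E → V,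
      u 0 = u₀ ∧ (∀ t, t ∉ Ioc 0 T → u t = u₀) ∧
      (∀ t, ContDiff ℝ 1 (u t)) ∧
      (∀ t x, ‖u t x‖ ≤ R ∧ ‖fderiv ℝ (u t) x‖ ≤ R) ∧
      StronglyMeasurable (uncurry u) ∧
      StronglyMeasurable (fun p : ℝ × E => fderiv ℝ (u p.1) p.2) ∧
      (∀ t ∈ Ioc 0 T, ∀ x, u t x = heatExtension u₀ t x +
        ∫ s in Ioo 0 t, heatExtension (fun y => f (y, u s y, fderiv ℝ (u s) y)) (t - s) x) := by
  classical
  -- ### constants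
  set c : ℝ := (2 : ℝ) ^ ((Module.finrank ℝ E : ℝ) / 2) with hc
  have hc1 : 1 ≤ c := Real.one_le_rpow (by norm_num) (by positivity)
  have hA₀ : 0 ≤ A₀ := hu₀.nonneg
  have hR0 : 0 ≤ R := by linarith
  set δ : ℝ := min (1 / (4 * c * (Lf + 1))) (1 / (2 * c * M + 1)) with hδ
  obtain ⟨hδ0, hδle, hsmallM, hsmallM', hsmallL, hsmallL'⟩ := smallness_constants hc1 hM hLf hδ
  have hT : T = δ ^ 2 := hTdef
  have hT0 : 0 < T := by rw [hT]; positivity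
  have hTδ : T ≤ δ := by rw [hT]; nlinarith
  have hsqrtT : T ^ (1 / 2 : ℝ) = δ := by rw [hT, ← Real.sqrt_eq_rpow, Real.sqrt_sq hδ0.le]
  have hsqrt_le : ∀ {t : ℝ}, 0 < t → t ≤ T → t ^ (1 / 2 : ℝ) ≤ δ := fun ht htT => by
    rw [← hsqrtT]; exact Real.rpow_le_rpow ht.le htT (by norm_num)
  have hfree : ∀ {t : ℝ}, 0 < t → IsCkBounded 1 A₀ (heatExtension u₀ t) :=
    fun ht => hu₀.heatExtension ht
  have hfree_m : StronglyMeasurable fun p : ℝ × E => heatExtension u₀ p.1 p.2 := by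
    have hG : StronglyMeasurable (uncurry fun (_ : ℝ) (y : E) => u₀ y) :=
      (hu₀.contDiff.continuous.stronglyMeasurable).comp_measurable measurable_snd
    exact stronglyMeasurable_heatExtension_param (α := ℝ) (G := fun _ y => u₀ y) (τ := id) hG
      measurable_id
  have hfreeD_meas : StronglyMeasurable fun p : ℝ × E =>
      if p.1 ∈ Ioc 0 T then fderiv ℝ (heatExtension u₀ p.1) p.2 else 0 := by
    have h1 : StronglyMeasurable fun p : ℝ × E => heatExtension (fderiv ℝ u₀) p.1 p.2 := by
      have hG : StronglyMeasurable (uncurry fun (_ : ℝ) (y : E) => fderiv ℝ u₀ y) :=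
        ((hu₀.contDiff.continuous_fderiv one_ne_zero).stronglyMeasurable).comp_measurable
          measurable_snd
      exact stronglyMeasurable_heatExtension_param (α := ℝ) (G := fun _ y => fderiv ℝ u₀ y)
        (τ := id) hG measurable_id
    have h2 : StronglyMeasurable fun p : ℝ × E =>
        if p.1 ∈ Ioc 0 T then heatExtension (fderiv ℝ u₀) p.1 p.2 else 0 :=
      h1.piecewise (measurable_fst measurableSet_Ioc) stronglyMeasurable_const
    have hfun : (fun p : ℝ × E => if p.1 ∈ Ioc 0 T then fderiv ℝ (heatExtension u₀ p.1) p.2 else 0) =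
        fun p : ℝ × E => if p.1 ∈ Ioc 0 T then heatExtension (fderiv ℝ u₀) p.1 p.2 else 0 := by
      funext p
      split_ifs with hp
      · exact fderiv_heatExtension_of_bounded hu₀.contDiff hu₀.norm_apply_le hu₀.norm_fderiv_le
          hp.1 p.2
      · rfl
    rw [hfun]
    exact h2
  set Pf : (ℝ × E → V × (E →L[ℝ] V)) → (ℝ × E → V × (E →L[ℝ] V)) := fun Φ p =>
    if p.1 ∈ Ioc 0 T then
      (heatExtension u₀ p.1 p.2 +
          ∫ s in Ioo 0 p.1, heatExtension (fun y => f (y, Φ (s, y))) (p.1 - s) p.2,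
        fderiv ℝ (heatExtension u₀ p.1) p.2 +
          fderiv ℝ (fun x => ∫ s in Ioo 0 p.1,
            heatExtension (fun y => f (y, Φ (s, y))) (p.1 - s) x) p.2)
    else 0 with hPf
  set Adm : (ℝ × E → V × (E →L[ℝ] V)) → Prop := fun Φ =>
    (∀ p, ‖Φ p‖ ≤ R) ∧ StronglyMeasurable Φ ∧ (∀ s, Continuous fun y => Φ (s, y)) ∧
      (∀ t ∈ Ioc 0 T, ∀ x, HasFDerivAt (fun y => (Φ (t, y)).1) ((Φ (t, x)).2) x) ∧
      ∀ p : ℝ × E, p.1 ∉ Ioc 0 T → Φ p = 0 with hAdm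
  have hdata : ∀ {Φ}, Adm Φ →
      StronglyMeasurable (uncurry fun s y => f (y, Φ (s, y))) ∧
        (∀ s, Continuous fun y => f (y, Φ (s, y))) ∧ ∀ s y, ‖f (y, Φ (s, y))‖ ≤ M :=
    fun hΦ => data_of_pairField hfc hfM hΦ.2.1 hΦ.2.2.1 hΦ.1
  have hPf_adm : ∀ {Φ}, Adm Φ → Adm (Pf Φ) := by
    intro Φ hΦ
    obtain ⟨hgm, hgc, hgC⟩ := hdata hΦ
    have hJd : ∀ t x, HasFDerivAt
        (fun x => ∫ s in Ioo 0 t, heatExtension (fun y => f (y, Φ (s, y))) (t - s) x)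
        (fderiv ℝ (fun x => ∫ s in Ioo 0 t,
          heatExtension (fun y => f (y, Φ (s, y))) (t - s) x) x) x :=
      fun t x => (hasFDerivAt_duhamel hgm hgc hgC t x).differentiableAt.hasFDerivAt
    have hJ0 : ∀ {t}, 0 < t → t ≤ T → ∀ x,
        ‖∫ s in Ioo 0 t, heatExtension (fun y => f (y, Φ (s, y))) (t - s) x‖ ≤ 1 := by
      intro t ht htT x
      calc _ ≤ M * t := norm_duhamel_le hgC ht.le x
        _ ≤ M * δ := by gcongr; exact htT.trans hTδ
        _ ≤ 1 := hsmallM'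
    have hJ1 : ∀ {t}, 0 < t → t ≤ T → ∀ x,
        ‖fderiv ℝ (fun x => ∫ s in Ioo 0 t,
          heatExtension (fun y => f (y, Φ (s, y))) (t - s) x) x‖ ≤ 1 := by
      intro t ht htT x
      calc _ ≤ 2 * c * M * t ^ (1 / 2 : ℝ) := norm_fderiv_duhamel_le hgm hgc hgC ht x
        _ ≤ 2 * c * M * δ := by gcongr; exact hsqrt_le ht htT
        _ ≤ 1 := hsmallM
    refine ⟨?_, ?_, ?_, ?_, ?_⟩
    · intro p
      by_cases hp : p.1 ∈ Ioc 0 T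
      · simp only [hPf, hp, if_true]
        rw [Prod.norm_def]
        refine max_le ?_ ?_
        · calc _ ≤ ‖heatExtension u₀ p.1 p.2‖ +
                ‖∫ s in Ioo 0 p.1, heatExtension (fun y => f (y, Φ (s, y))) (p.1 - s) p.2‖ :=
                norm_add_le _ _
            _ ≤ A₀ + 1 := add_le_add ((hfree hp.1).norm_apply_le p.2) (hJ0 hp.1 hp.2 p.2)
            _ ≤ R := hR
        · calc _ ≤ ‖fderiv ℝ (heatExtension u₀ p.1) p.2‖ +
                ‖fderiv ℝ (fun x => ∫ s in Ioo 0 p.1,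
                  heatExtension (fun y => f (y, Φ (s, y))) (p.1 - s) x) p.2‖ := norm_add_le _ _
            _ ≤ A₀ + 1 := add_le_add ((hfree hp.1).norm_fderiv_le p.2) (hJ1 hp.1 hp.2 p.2)
            _ ≤ R := hR
      · simp only [hPf, hp, if_false, norm_zero]
        exact hR0
    · have hJm := stronglyMeasurable_duhamel hgm
      have hDJm := stronglyMeasurable_fderiv_duhamel hgm hgc hgC
      have hG₁ := hfree_m.add hJm
      have hG₂ := hfreeD_meas.add hDJm
      have hfun : Pf Φ = {p : ℝ × E | p.1 ∈ Ioc 0 T}.piecewise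
          (fun p => (heatExtension u₀ p.1 p.2 +
              ∫ s in Ioo 0 p.1, heatExtension (fun y => f (y, Φ (s, y))) (p.1 - s) p.2,
            (if p.1 ∈ Ioc 0 T then fderiv ℝ (heatExtension u₀ p.1) p.2 else 0) +
              fderiv ℝ (fun x => ∫ s in Ioo 0 p.1,
                heatExtension (fun y => f (y, Φ (s, y))) (p.1 - s) x) p.2))
          (fun _ => 0) := by
        funext p
        by_cases hp : p.1 ∈ Ioc 0 T
        · rw [Set.piecewise_eq_of_mem _ _ _ (show p ∈ {p : ℝ × E | p.1 ∈ Ioc 0 T} from hp)]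
          simp only [hPf, hp, if_true]
        · rw [Set.piecewise_eq_of_notMem _ _ _ (show p ∉ {p : ℝ × E | p.1 ∈ Ioc 0 T} from hp)]
          simp only [hPf, hp, if_false]
      rw [hfun]
      exact (hG₁.prodMk hG₂).piecewise (measurable_fst measurableSet_Ioc) stronglyMeasurable_const
    · intro s
      by_cases hs : s ∈ Ioc 0 T
      · have hfun : (fun y => Pf Φ (s, y)) = fun y =>
            (heatExtension u₀ s y +
                ∫ r in Ioo 0 s, heatExtension (fun y => f (y, Φ (r, y))) (s - r) y,
              fderiv ℝ (heatExtension u₀ s) y +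
                fderiv ℝ (fun x => ∫ r in Ioo 0 s,
                  heatExtension (fun y => f (y, Φ (r, y))) (s - r) x) y) := by
          funext y; simp only [hPf, hs, if_true]
        rw [hfun]
        have hJc : Continuous fun x => ∫ r in Ioo 0 s,
            heatExtension (fun y => f (y, Φ (r, y))) (s - r) x :=
          (show Differentiable ℝ _ from fun x => (hJd s x).differentiableAt).continuous
        exact (((hfree hs.1).contDiff.continuous).add hJc).prodMk
          (((hfree hs.1).contDiff.continuous_fderiv one_ne_zero).add
            (continuous_fderiv_duhamel hgm hgc hgC s))
      · have hfun : (fun y => Pf Φ (s, y)) = fun _ => 0 := by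
          funext y; simp only [hPf, hs, if_false]
        rw [hfun]
        exact continuous_const
    · intro t ht x
      have hfun : (fun y => (Pf Φ (t, y)).1) = fun y =>
          heatExtension u₀ t y +
            ∫ r in Ioo 0 t, heatExtension (fun y => f (y, Φ (r, y))) (t - r) y := by
        funext y; simp only [hPf, ht, if_true]
      have hval : (Pf Φ (t, x)).2 = fderiv ℝ (heatExtension u₀ t) x +
          fderiv ℝ (fun x => ∫ r in Ioo 0 t,
            heatExtension (fun y => f (y, Φ (r, y))) (t - r) x) x := by
        simp only [hPf, ht, if_true]
      rw [hfun, hval]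
      exact (((hfree ht.1).contDiff.differentiable one_ne_zero) x).hasFDerivAt.add (hJd t x)
    · intro p hp
      simp only [hPf, hp, if_false]
  have hPf_lip : ∀ {Φ Ψ}, Adm Φ → Adm Ψ → ∀ {D : ℝ}, 0 ≤ D → (∀ q, ‖Φ q - Ψ q‖ ≤ D) →
      ∀ p, ‖Pf Φ p - Pf Ψ p‖ ≤ 1 / 2 * D := by
    intro Φ Ψ hΦ hΨ D hD hΦΨ p
    obtain ⟨hgm₁, hgc₁, hgC₁⟩ := hdata hΦ
    obtain ⟨hgm₂, hgc₂, hgC₂⟩ := hdata hΨ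
    have hdiff : ∀ s y, ‖f (y, Φ (s, y)) - f (y, Ψ (s, y))‖ ≤ Lf * D := fun s y =>
      (hfL y _ _ (hΦ.1 _) (hΨ.1 _)).trans (mul_le_mul_of_nonneg_left (hΦΨ (s, y)) hLf)
    have hgm : StronglyMeasurable (uncurry fun s y => f (y, Φ (s, y)) - f (y, Ψ (s, y))) :=
      hgm₁.sub hgm₂
    have hgc : ∀ s, Continuous fun y => f (y, Φ (s, y)) - f (y, Ψ (s, y)) := fun s =>
      (hgc₁ s).sub (hgc₂ s)
    by_cases hp : p.1 ∈ Ioc 0 T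
    · have hpδ : p.1 ≤ δ := hp.2.trans hTδ
      simp only [hPf, hp, if_true, Prod.mk_sub_mk, add_sub_add_left_eq_sub]
      rw [Prod.norm_def]
      refine max_le ?_ ?_
      · rw [duhamel_sub_apply hgm₁ hgm₂ hgc₁ hgc₂ hgC₁ hgC₂]
        calc _ ≤ Lf * D * p.1 := norm_duhamel_le hdiff hp.1.le p.2
          _ ≤ Lf * D * δ := by gcongr
          _ = (Lf * δ) * D := by ring
          _ ≤ 1 / 2 * D := mul_le_mul_of_nonneg_right hsmallL' hD
      · rw [fderiv_duhamel_sub_apply hgm₁ hgm₂ hgc₁ hgc₂ hgC₁ hgC₂]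
        calc _ ≤ 2 * c * (Lf * D) * p.1 ^ (1 / 2 : ℝ) :=
              norm_fderiv_duhamel_le hgm hgc hdiff hp.1 p.2
          _ ≤ 2 * c * (Lf * D) * δ := by gcongr; exact hsqrt_le hp.1 hp.2
          _ = (2 * c * Lf * δ) * D := by ring
          _ ≤ 1 / 2 * D := mul_le_mul_of_nonneg_right hsmallL hD
    · simp only [hPf, hp, if_false, sub_zero, norm_zero]
      positivity
  set S : Set (lp (fun _ : ℝ × E => V × (E →L[ℝ] V)) ∞) := {Φ | Adm ⇑Φ} with hS
  have hmemS : ∀ {Φ : lp (fun _ : ℝ × E => V × (E →L[ℝ] V)) ∞}, Φ ∈ S ↔ Adm ⇑Φ :=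
    fun {Φ} => Iff.rfl
  have hPf_mem : ∀ Φ : lp (fun _ : ℝ × E => V × (E →L[ℝ] V)) ∞, Φ ∈ S → Memℓp (Pf ⇑Φ) ∞ := by
    intro Φ hΦ
    refine memℓp_infty ⟨R, ?_⟩
    rintro _ ⟨p, rfl⟩; exact (hPf_adm (hmemS.1 hΦ)).1 p
  let Pmap : lp (fun _ : ℝ × E => V × (E →L[ℝ] V)) ∞ → lp (fun _ : ℝ × E => V × (E →L[ℝ] V)) ∞ :=
    fun Φ => if h : Φ ∈ S then ⟨Pf ⇑Φ, hPf_mem Φ h⟩ else Φ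
  have hPmap_coe : ∀ {Φ : lp (fun _ : ℝ × E => V × (E →L[ℝ] V)) ∞}, Φ ∈ S →
      ⇑(Pmap Φ) = Pf ⇑Φ := by
    intro Φ hΦ; simp only [Pmap, dif_pos hΦ]
  have heval : ∀ (Φ Ψ : lp (fun _ : ℝ × E => V × (E →L[ℝ] V)) ∞) (q : ℝ × E),
      ‖Φ q - Ψ q‖ ≤ ‖Φ - Ψ‖ := by
    intro Φ Ψ q
    rw [← Pi.sub_apply, ← lp.coeFn_sub]
    exact lp.norm_apply_le_norm ENNReal.top_ne_zero _ q
  have hSclosed : IsClosed S := isClosed_admissible (E := E) (V := V) R T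
  have hScomplete : IsComplete S := hSclosed.isComplete
  have hmaps : MapsTo Pmap S S := by
    intro Φ hΦ
    refine hmemS.2 ?_
    rw [hPmap_coe hΦ]; exact hPf_adm (hmemS.1 hΦ)
  have hlip : ∀ {Φ Ψ : lp (fun _ : ℝ × E => V × (E →L[ℝ] V)) ∞}, Φ ∈ S → Ψ ∈ S →
      ‖Pmap Φ - Pmap Ψ‖ ≤ 1 / 2 * ‖Φ - Ψ‖ := by
    intro Φ Ψ hΦ hΨ
    refine lp.norm_le_of_forall_le (by positivity) fun p => ?_
    rw [lp.coeFn_sub, Pi.sub_apply, hPmap_coe hΦ, hPmap_coe hΨ]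
    exact hPf_lip (hmemS.1 hΦ) (hmemS.1 hΨ) (norm_nonneg _) (heval Φ Ψ) p
  have hcontr : ContractingWith ((1 : ℝ≥0) / 2) (hmaps.restrict Pmap S S) := by
    refine ⟨by rw [div_lt_one (by norm_num)]; norm_num,
      LipschitzWith.of_dist_le_mul fun Φ Ψ => ?_⟩
    rw [Subtype.dist_eq, MapsTo.val_restrict_apply, MapsTo.val_restrict_apply, Subtype.dist_eq,
      dist_eq_norm, dist_eq_norm]
    push_cast
    exact hlip Φ.2 Ψ.2
  have h0S : (0 : lp (fun _ : ℝ × E => V × (E →L[ℝ] V)) ∞) ∈ S := by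
    refine hmemS.2 ?_
    rw [lp.coeFn_zero]
    refine ⟨?_, ?_, ?_, ?_, ?_⟩
    · intro p; simp [hR0]
    · exact stronglyMeasurable_const
    · intro s; exact continuous_const
    · intro t _ x
      exact hasFDerivAt_const (0 : V) x
    · intro p _; rfl
  obtain ⟨Φs, hΦsS, hfix, -⟩ :=
    ContractingWith.exists_fixedPoint' hScomplete hmaps hcontr h0S (edist_ne_top _ _)
  have hAs' : Adm ⇑Φs := hmemS.1 hΦsS
  set Φf : ℝ × E → V × (E →L[ℝ] V) := ⇑Φs with hΦf
  have hAs : Adm Φf := hAs'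
  have hPfix : Pf Φf = Φf := by
    have h : ⇑(Pmap Φs) = ⇑Φs :=
      congrArg (fun Ψ : lp (fun _ : ℝ × E => V × (E →L[ℝ] V)) ∞ => (⇑Ψ : ℝ × E → _)) hfix
    rw [hPmap_coe hΦsS] at h
    rw [hΦf]
    exact h
  have hslice : ∀ {t}, t ∈ Ioc 0 T → ∀ x,
      HasFDerivAt (fun y => (Φf (t, y)).1) ((Φf (t, x)).2) x :=
    fun ht x => hAs.2.2.2.1 _ ht x
  have hslice_fd : ∀ {t}, t ∈ Ioc 0 T →
      fderiv ℝ (fun y => (Φf (t, y)).1) = fun x => (Φf (t, x)).2 :=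
    fun ht => funext fun x => (hslice ht x).fderiv
  have hslice_c1 : ∀ {t}, t ∈ Ioc 0 T → ContDiff ℝ 1 (fun y => (Φf (t, y)).1) := by
    intro t ht
    rw [contDiff_one_iff_fderiv]
    refine ⟨fun x => (hslice ht x).differentiableAt, ?_⟩
    rw [hslice_fd ht]
    exact continuous_snd.comp (hAs.2.2.1 t)
  set u : ℝ → E → V := fun t x => if t ∈ Ioc 0 T then (Φf (t, x)).1 else u₀ x with hu
  have hu_in : ∀ {t}, t ∈ Ioc 0 T → u t = fun x => (Φf (t, x)).1 := fun ht => funext fun x => by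
    simp only [hu, ht, if_true]
  have hu_out : ∀ {t}, t ∉ Ioc 0 T → u t = u₀ := fun ht => funext fun x => by
    simp only [hu, ht, if_false]
  have h0T : (0 : ℝ) ∉ Ioc 0 T := fun h => lt_irrefl _ h.1
  have hfd_in : ∀ {t}, t ∈ Ioc 0 T → ∀ x, fderiv ℝ (u t) x = (Φf (t, x)).2 := fun ht x => by
    rw [hu_in ht, hslice_fd ht]
  refine ⟨hT0, hTδ.trans hδle, u, hu_out h0T, fun t ht => hu_out ht, ?_, ?_, ?_, ?_, ?_⟩
  · intro t
    by_cases ht : t ∈ Ioc 0 T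
    · rw [hu_in ht]; exact hslice_c1 ht
    · rw [hu_out ht]; exact hu₀.contDiff
  · intro t x
    by_cases ht : t ∈ Ioc 0 T
    · rw [hfd_in ht x, hu_in ht]
      exact ⟨(norm_fst_le _).trans (hAs.1 _), (norm_snd_le _).trans (hAs.1 _)⟩
    · rw [hu_out ht]
      exact ⟨(hu₀.norm_apply_le x).trans (by linarith), (hu₀.norm_fderiv_le x).trans (by linarith)⟩
  · have hfun : uncurry u =
        {p : ℝ × E | p.1 ∈ Ioc 0 T}.piecewise (fun p => (Φf p).1) fun p => u₀ p.2 := by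
      funext p
      by_cases hp : p.1 ∈ Ioc 0 T
      · rw [Set.piecewise_eq_of_mem _ _ _ (show p ∈ {p : ℝ × E | p.1 ∈ Ioc 0 T} from hp)]
        simp only [uncurry, hu, hp, if_true]
      · rw [Set.piecewise_eq_of_notMem _ _ _ (show p ∉ {p : ℝ × E | p.1 ∈ Ioc 0 T} from hp)]
        simp only [uncurry, hu, hp, if_false]
    rw [hfun]
    exact (continuous_fst.comp_stronglyMeasurable hAs.2.1).piecewise
      (measurable_fst measurableSet_Ioc)
      ((hu₀.contDiff.continuous.stronglyMeasurable).comp_measurable measurable_snd)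
  · have hfun : (fun p : ℝ × E => fderiv ℝ (u p.1) p.2) =
        {p : ℝ × E | p.1 ∈ Ioc 0 T}.piecewise (fun p => (Φf p).2) fun p => fderiv ℝ u₀ p.2 := by
      funext p
      by_cases hp : p.1 ∈ Ioc 0 T
      · rw [Set.piecewise_eq_of_mem _ _ _ (show p ∈ {p : ℝ × E | p.1 ∈ Ioc 0 T} from hp)]
        exact hfd_in hp p.2
      · rw [Set.piecewise_eq_of_notMem _ _ _ (show p ∉ {p : ℝ × E | p.1 ∈ Ioc 0 T} from hp),
          hu_out hp]
    rw [hfun]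
    exact (continuous_snd.comp_stronglyMeasurable hAs.2.1).piecewise
      (measurable_fst measurableSet_Ioc)
      (((hu₀.contDiff.continuous_fderiv one_ne_zero).stronglyMeasurable).comp_measurable
        measurable_snd)
  · intro t ht x
    have h := congrFun hPfix (t, x)
    have h1 : (Φf (t, x)).1 = heatExtension u₀ t x +
        ∫ s in Ioo 0 t, heatExtension (fun y => f (y, Φf (s, y))) (t - s) x := by
      rw [← h]
      simp only [hPf, ht, if_true]
    rw [hu_in ht]
    dsimp only
    rw [h1]
    congr 1
    refine setIntegral_congr_fun measurableSet_Ioo fun s hs => ?_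
    have hs' : s ∈ Ioc 0 T := ⟨hs.1, hs.2.le.trans ht.2⟩
    have hF : (fun y => f (y, Φf (s, y))) = fun y => f (y, u s y, fderiv ℝ (u s) y) := by
      funext y
      rw [hfd_in hs' y, hu_in hs']
    rw [hF]

/-- Anchor (registered sub-stub of stub W2): `mild_solution_explicit` in closed form. -/
theorem w2aux_mildSolutionExplicit : ∀ {E : Type} [NormedAddCommGroup E] [InnerProductSpace ℝ E]
    [FiniteDimensional ℝ E] [MeasurableSpace E] [BorelSpace E] {V : Type} [NormedAddCommGroup V]
    [NormedSpace ℝ V] [CompleteSpace V] (f : E × V × (E →L[ℝ] V) → V), Continuous f →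
    ∀ {u₀ : E → V} {A₀ : ℝ}, IsCkBounded 1 A₀ u₀ → ∀ {R M Lf : ℝ}, A₀ + 1 ≤ R → 0 ≤ M → 0 ≤ Lf →
    (∀ (x : E) (w : V × (E →L[ℝ] V)), ‖w‖ ≤ R → ‖f (x, w)‖ ≤ M) →
    (∀ (x : E) (w w' : V × (E →L[ℝ] V)), ‖w‖ ≤ R → ‖w'‖ ≤ R →
      ‖f (x, w) - f (x, w')‖ ≤ Lf * ‖w - w'‖) →
    ∀ {T : ℝ}, T = (min (1 / (4 * (2 : ℝ) ^ ((Module.finrank ℝ E : ℝ) / 2) * (Lf + 1)))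
      (1 / (2 * (2 : ℝ) ^ ((Module.finrank ℝ E : ℝ) / 2) * M + 1))) ^ 2 →
    0 < T ∧ T ≤ 1 ∧ ∃ u : ℝ → E → V,
      u 0 = u₀ ∧ (∀ t, t ∉ Ioc 0 T → u t = u₀) ∧
      (∀ t, ContDiff ℝ 1 (u t)) ∧
      (∀ t x, ‖u t x‖ ≤ R ∧ ‖fderiv ℝ (u t) x‖ ≤ R) ∧
      StronglyMeasurable (uncurry u) ∧
      StronglyMeasurable (fun p : ℝ × E => fderiv ℝ (u p.1) p.2) ∧
      (∀ t ∈ Ioc 0 T, ∀ x, u t x = heatExtension u₀ t x +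
        ∫ s in Ioo 0 t, heatExtension (fun y => f (y, u s y, fderiv ℝ (u s) y)) (t - s) x) :=
  fun f hfc _ _ hu₀ _ _ _ hR hM hLf hfM hfL _ hT => mild_solution_explicit f hfc hu₀ hR hM hLf hfM hfL hT

end Summit.NavierStokesRegularity.NavierStokesRegularity.Theorems.SelfMixingDichotomy.MixingPayoffBirth

end
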